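/- Copyright: the b2b-balaban cell (near-miss cell 7), T⁴-continuum fan-out; row NE7b ROUND-2 swarm, seat
t4-ne7b-formalise-leaf-06 (gen 6) (road W-RP, row W4 file 4c «CUBE CELLS»: the tower-law reading with cells the cubes
of side `L^{m₁}` of the unit lattice; INTENT journal l.16399 ff.).  Released under the licence of the surrounding
project. -/
import Summits.QuantumFields.BalabanUV.T4Continuum.Support.HistoryChessboardEventsTower

/-!
# Road W-RP, row W4 file 4c: CUBE CELLS — the tower-law reading on the block torus of `L^{m₁}`-cubes

Summits-side support leaf of the T⁴-continuum cell (rung (B)+1 on a FINITE torus only; NOT infinite volume, NOT the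
mass gap, NOT the Clay statement; NOT a proof of the spine estimate NE7b).  Row NE7b, road **W-RP** (R-OWNER-23-2 ∕
R-OWNER-23-8), row **W4**, file 4c, on top of files 4a∕4b (`HistoryChessboardEventsSplit`∕`…Tower`, this lineage) and
W3m (`HistoryRPTowerCuts`, leaf-04 g6).  [folklore] bookkeeping over TREE theorems; DATA defs `mulIdx`, `cubeCut`,
`cubeRefl` (+ `abbrev cubePos`); no `structure`, no `[cite:]` tag, no `Prop`-valued FACT minted (c1), no constant
(c2∕c6), no exit ∕ socket ∕ `HistoryConstants` file touched (c3).

WHY (a located limitation of file 4b, not a change of content).  File 4b indexes W4's block torus by the SITES of the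
unit lattice (`N = 2·L^m` cells per direction): a cell is a unit cube, so a cell event can read every level `< K` of the
tower under that cube but NO bond of the top field `Ū^K` (a unit-lattice bond joins two cells; W3h∕W3c's between-sites
cuts put it in neither half).  Bałaban's large-field conditions at the last step read the top fields on CUBES; the
chessboard for such events runs on the torus of cubes of side `M = L^{m₁}` (`N = 2·L^{m−m₁}` cubes per direction — still
EVEN), with reflections in the CUBE-boundary hyperplanes only: the sub-family `k ↦ M·k` of W3m's all-hyperplane family.
This file does that re-indexing once, generically and for the Gibbs towers; with `m₁ = 0` it is file 4b again.

WHAT.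
* §1 `mulIdx M : ZMod N → ZMod (M * N)` (`k ↦ M·k`, well defined), `val_mulIdx`; `cubeIdx M N` (`x ↦ ⌊x∕M⌋` in `ZMod N`);
  the two ARITHMETIC LETTERS of the cube geometry: **`val_sub_mulIdx_lt_half`** (cube in `halfPlus N i k` ⇒ label in the
  positive slab of the unit hyperplane `M·k` — the `loc` side) and **`cubeIdx_reflect`** (the unit reflection `x ↦ 2Mk − 1 − x`
  acts on cube indices by `cellReflect`'s `c ↦ 2k − 1 − c` — the `sym` side), + their `castZ` forms; **`rp5_reindex`**: any
  RP five-tuple indexed by `ZMod N₁` re-indexed along any map `ZMod N → ZMod N₁` (pointwise); `EventSide.cutoffReading_reindex`.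
* §2 the tower at cube cuts: `cubeCut (h : P.sitesPerDir K = M * N) k := castZ h.symm (mulIdx M k)`, `val_sub_cubeCut_lt_half`,
  `cubeIdx_reflect_cubeCut` (the letters a column-algebra `loc`∕`sym` supplier consumes — W3n, leaf-07 g5), `cubePos`, `cubeRefl`; **`cutoffRP_towerLaw_gibbs_SU_cubes`** (W3m's `cutoffRP_towerLaw_gibbs_SU` at the cube cuts) and
  **`EventSide.cutoffReading_towerLaw_gibbs_SU_cubes`** — W4b′'s reading over the block torus `BlockIdx P.d N` of cubes
  from the event half alone.
* §3 the cutoff family: `sitesPerDir_cutoffParams_self_eq_mul (hm₁ : m₁ ≤ P₀.m) : … = L^{m₁} * (2·L^{m−m₁})`,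
  `even_cubeCount`; the END **`hybridNE7_of_towerEventSidesCubes_SU`**: two families of EVENT HALVES over the cube tori
  (`N := 2·P₀.L^(P₀.m − m₁)` — the same type at every cutoff, so file 3's `hybridNE7_of_cutoffReadings` applies with NO
  transport) ⇒ `HybridNE7` with weight `e^{2·ob·l₀}·#P·N^d·(r + r′)`; NO `Even`, NO RP, NO `prob` hypothesis left.

HONEST SCOPE (R-OWNER-23-8 wording for road W-RP).  Displayed for an instantiating seat: file 4a's `EventSide` over the
cube torus — (EXT) event model (`repr`, `ev_cover`, `bad_disj`, `bad_sub`), (LOC)∕(R-sym) of ITS cube events relative to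
`cubePos`∕`cubeRefl` (coordinate-level suppliers: W3m file 2 `HistoryRPTowerCells`; the cube GEOMETRY «`halfPlus N i k`
cubes ↔ bonds with `i`-labels in `[M·k, M·k + N·M∕2)` at the top level and their scaled columns below; `cellReflect i k` ↔
`cutBond`» is that seat's), (U1)+(G2) (`univ_le`).  Typing identification «`blockAvg ℰ` is (0.4)» T-class; the torus
scheme `towerLaw (gibbsMeasure (cutoffParams P₀ K) β_K) (blockAvg ℰ_K) K` is the cell's own definition.  Nothing of H3 ∕ (B)
∕ BetaPertH discharged; 0∕9 unchanged.  NE7b NOT proved; spine 0∕9.  HONEST DEPENDENCY (cell): continuum YM on T⁴ ⇐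
BetaPertH ∧ nine spine estimates (0/9 proved); BetaPertH ⇐ (D1) ∧ (D4) ∧ CAP+tail; G-an2-4 gates asym, D1 and NE2/3/4.
This file changes none of it.
-/

open Finset MeasureTheory Literature.Barriers.CriticalPhenomena.NonGibbs Literature.Probability.LatticeModels
open Literature.MathematicalPhysics.QuantumFieldTheory.Balaban1983to89
open T4IndicatorShell T4MatchingAssembly T4MatchingClosure
open Literature.MathematicalPhysics.QuantumFieldTheory.LatticeRP (IsReflectionPositiveBdd)
open Summit.QuantumFields.BalabanUV.T4Continuum HistoryChessboardAssembly HistoryChessboardEvents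
open HistoryChessboardEventsCutoff HistoryChessboardEventsSplit HistoryChessboardEventsTower HistoryRPTowerLaw
open HistoryRPTowerCuts BlockAveraging

namespace Summit.QuantumFields.BalabanUV.T4Continuum.HistoryChessboardEventsCubes

noncomputable section

/-! ## §1 Re-indexing an RP five-tuple; the cube-boundary index map `k ↦ M·k` -/

section Reindex

variable {M N : ℕ}

/-- **THE CUBE-BOUNDARY INDEX**: the `k`-th boundary hyperplane of cubes of side `M` is the unit hyperplane `M·k`
(`ZMod N → ZMod (M * N)`, well defined through the canonical representative). -/
def mulIdx (M : ℕ) {N : ℕ} (k : ZMod N) : ZMod (M * N) := ((M * k.val : ℕ) : ZMod (M * N))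

/-- the representative of the cube-boundary index. [folklore] -/
@[simp] theorem val_mulIdx [NeZero N] (M : ℕ) (k : ZMod N) : (mulIdx M k).val = M * k.val := by
  rw [mulIdx, ZMod.val_natCast]
  rcases Nat.eq_zero_or_pos M with hM | hM
  · subst hM; simp
  · exact Nat.mod_eq_of_lt (Nat.mul_lt_mul_of_pos_left (ZMod.val_lt k) hM)

/-- `mulIdx 1` is the identity (up to `1 * N = N`). [folklore] -/
theorem mulIdx_one [NeZero N] (k : ZMod N) : mulIdx 1 k = castZ (one_mul N).symm k := by
  apply ZMod.val_injective
  haveI : NeZero (1 * N) := ⟨by rw [one_mul]; exact NeZero.ne N⟩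
  rw [val_mulIdx, one_mul, val_castZ]

/-- **THE CUBE INDEX OF A UNIT-LATTICE LABEL**: `⌊x ∕ M⌋`, read in `ZMod N` (cubes of side `M`, `N` per direction). -/
def cubeIdx (M N : ℕ) {N₁ : ℕ} (x : ZMod N₁) : ZMod N := ((x.val / M : ℕ) : ZMod N)

/-- `(M·a + s) % (M·N) = M·(a % N) + s` for `s < M`. [folklore] -/
theorem mul_add_mod_mul [NeZero N] (a : ℕ) {s : ℕ} (hs : s < M) : (M * a + s) % (M * N) = M * (a % N) + s := by
  have hdecomp : M * a + s = (M * N) * (a / N) + (M * (a % N) + s) := by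
    have := Nat.div_add_mod a N
    calc M * a + s = M * (N * (a / N) + a % N) + s := by rw [this]
      _ = (M * N) * (a / N) + (M * (a % N) + s) := by ring
  have hlt : M * (a % N) + s < M * N := by
    have h1 : a % N + 1 ≤ N := Nat.mod_lt a (Nat.pos_of_ne_zero (NeZero.ne N))
    calc M * (a % N) + s < M * (a % N) + M := by omega
      _ = M * (a % N + 1) := by ring
      _ ≤ M * N := Nat.mul_le_mul_left M h1
  rw [hdecomp, Nat.mul_add_mod, Nat.mod_eq_of_lt hlt]

/-- `(M·a + s) ∕ M = a` for `s < M`. [folklore] -/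
theorem mul_add_div_of_lt (a : ℕ) {s : ℕ} (hs : s < M) : (M * a + s) / M = a := by
  have hM : 0 < M := by omega
  rw [show M * a + s = s + M * a by ring, Nat.add_mul_div_left _ _ hM, Nat.div_eq_of_lt hs, zero_add]

/-- `M ≠ 0` when `M·N ≠ 0`. [folklore] -/
theorem pos_of_neZero_mul [h : NeZero (M * N)] : 0 < M := Nat.pos_of_ne_zero (mul_ne_zero_iff.1 h.ne).1

/-- **SLAB ARITHMETIC** (the `loc` side): if the cube of the label `x` lies in W3e's positive half `halfPlus N i k` of the
cube torus (`(⌊x∕M⌋ − k).val < N∕2`), then `x` lies in the positive slab of the unit hyperplane `M·k`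
(`(x − M·k).val < M·N∕2`). [folklore] -/
theorem val_sub_mulIdx_lt_half [NeZero N] [NeZero (M * N)] (x : ZMod (M * N)) (k : ZMod N)
    (hc : (cubeIdx M N x - k).val < N / 2) : (x - mulIdx M k).val < M * N / 2 := by
  have hM : 0 < M := pos_of_neZero_mul (N := N)
  set c := x.val / M with hc_def
  set r := x.val % M with hr_def
  have hx : x.val = M * c + r := (Nat.div_add_mod x.val M).symm
  set q := ((((c : ℕ) : ZMod N)) - k).val with hq_def
  have hcq : ((c : ℕ) : ZMod N) = ((k.val + q : ℕ) : ZMod N) := by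
    have e : ((c : ℕ) : ZMod N) = k + (((c : ℕ) : ZMod N) - k) := by ring
    rw [Nat.cast_add, ZMod.natCast_zmod_val, hq_def, ZMod.natCast_zmod_val]
    exact e
  have hmod : c ≡ k.val + q [MOD N] := (ZMod.natCast_eq_natCast_iff _ _ _).1 hcq
  have hmod2 : M * c + r ≡ M * (k.val + q) + r [MOD M * N] := (hmod.mul_left' M).add_right r
  have hval : x - mulIdx M k = ((M * q + r : ℕ) : ZMod (M * N)) := by
    have hx' : x = ((M * c + r : ℕ) : ZMod (M * N)) := by rw [← hx, ZMod.natCast_zmod_val]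
    rw [mulIdx, hx', (ZMod.natCast_eq_natCast_iff _ _ _).2 hmod2]
    push_cast
    ring
  rw [hval, ZMod.val_natCast]
  have hq : q < N / 2 := hc
  have hr : r < M := Nat.mod_lt _ hM
  have h1 : M * q + r < M * (N / 2) := by
    calc M * q + r < M * q + M := by omega
      _ = M * (q + 1) := by ring
      _ ≤ M * (N / 2) := Nat.mul_le_mul_left M (by omega)
  exact lt_of_le_of_lt (Nat.mod_le _ _) (lt_of_lt_of_le h1 (Nat.mul_div_le_mul_div_assoc M N 2))

/-- **REFLECTION ARITHMETIC** (the `sym` side): the unit reflection in the hyperplane `M·k`, `x ↦ 2·M·k − 1 − x`, acts on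
cube indices by W3e's `cellReflect`: `⌊(2Mk − 1 − x)∕M⌋ = 2k − 1 − ⌊x∕M⌋` in `ZMod N`. [folklore] -/
theorem cubeIdx_reflect [NeZero N] [NeZero (M * N)] (x : ZMod (M * N)) (k : ZMod N) :
    cubeIdx M N (2 * mulIdx M k - 1 - x) = 2 * k - 1 - cubeIdx M N x := by
  have hM : 0 < M := pos_of_neZero_mul (N := N)
  unfold cubeIdx
  set c := x.val / M with hc_def
  set r := x.val % M with hr_def
  have hx : x.val = M * c + r := (Nat.div_add_mod x.val M).symm
  have hr : r < M := Nat.mod_lt _ hM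
  have hcN : c < N := Nat.div_lt_of_lt_mul (ZMod.val_lt x)
  have h1 : c + 1 ≤ 2 * N + 2 * k.val := by omega
  have h2 : r + 1 ≤ M := hr
  have hY : (2 * mulIdx M k - 1 - x) =
      ((M * (2 * N + 2 * k.val - (c + 1)) + (M - (r + 1)) : ℕ) : ZMod (M * N)) := by
    have hx' : x = ((M * c + r : ℕ) : ZMod (M * N)) := by rw [← hx, ZMod.natCast_zmod_val]
    have hMN : ((M : ZMod (M * N))) * (N : ZMod (M * N)) = 0 := by exact_mod_cast ZMod.natCast_self (M * N)
    rw [mulIdx, hx']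
    push_cast [Nat.cast_sub h1, Nat.cast_sub h2]
    linear_combination (-2 : ZMod (M * N)) * hMN
  rw [hY, ZMod.val_natCast, mul_add_mod_mul _ (by omega : M - (r + 1) < M),
    mul_add_div_of_lt _ (by omega : M - (r + 1) < M), ZMod.natCast_mod]
  have hNz : ((N : ℕ) : ZMod N) = 0 := ZMod.natCast_self N
  push_cast [Nat.cast_sub h1]
  rw [ZMod.natCast_zmod_val]
  linear_combination (2 : ZMod N) * hNz

/-- The slab arithmetic along an equality of moduli `N₁ = M·N` (the letters of §2: `N₁ := P.sitesPerDir K`). [folklore] -/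
theorem val_sub_castZ_mulIdx_lt_half {N₁ : ℕ} [NeZero N] [NeZero N₁] (h : N₁ = M * N) (x : ZMod N₁) (k : ZMod N)
    (hc : (cubeIdx M N x - k).val < N / 2) : (x - castZ h.symm (mulIdx M k)).val < N₁ / 2 := by
  subst h
  exact val_sub_mulIdx_lt_half x k hc

/-- The reflection arithmetic along `N₁ = M·N`. [folklore] -/
theorem cubeIdx_reflect_castZ {N₁ : ℕ} [NeZero N] [NeZero N₁] (h : N₁ = M * N) (x : ZMod N₁) (k : ZMod N) :
    cubeIdx M N (2 * castZ h.symm (mulIdx M k) - 1 - x) = 2 * k - 1 - cubeIdx M N x := by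
  subst h
  exact cubeIdx_reflect x k

variable {Ω ι Λ : Type*} [MeasurableSpace Ω] {d N₁ : ℕ} {μ : Measure Ω} {θ : Fin d → ZMod N₁ → Ω → Ω}
  {mP : Fin d → ZMod N₁ → MeasurableSpace Ω}

/-- **RE-INDEXING AN RP FIVE-TUPLE** along any index map `φ : ZMod N → ZMod N₁` (pointwise restriction). [folklore] -/
theorem rp5_reindex (φ : ZMod N → ZMod N₁)
    (h5 : (∀ (i : Fin d) (k : ZMod N₁), mP i k ≤ ‹MeasurableSpace Ω›) ∧
      (∀ (i : Fin d) (k : ZMod N₁), Measurable (θ i k)) ∧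
      (∀ (i : Fin d) (k : ZMod N₁), MeasurePreserving (θ i k) μ μ) ∧
      (∀ (i : Fin d) (k : ZMod N₁), θ i k ∘ θ i k = id) ∧
      (∀ (i : Fin d) (k : ZMod N₁), IsReflectionPositiveBdd μ (mP i k) (θ i k))) :
    (∀ (i : Fin d) (k : ZMod N), mP i (φ k) ≤ ‹MeasurableSpace Ω›) ∧
      (∀ (i : Fin d) (k : ZMod N), Measurable (θ i (φ k))) ∧
      (∀ (i : Fin d) (k : ZMod N), MeasurePreserving (θ i (φ k)) μ μ) ∧
      (∀ (i : Fin d) (k : ZMod N), θ i (φ k) ∘ θ i (φ k) = id) ∧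
      (∀ (i : Fin d) (k : ZMod N), IsReflectionPositiveBdd μ (mP i (φ k)) (θ i (φ k))) :=
  ⟨fun i k => h5.1 i (φ k), fun i k => h5.2.1 i (φ k), fun i k => h5.2.2.1 i (φ k), fun i k => h5.2.2.2.1 i (φ k),
    fun i k => h5.2.2.2.2 i (φ k)⟩

variable [NeZero N] {P : Finset Λ} {T : Finset ι} {A : ℝ → ι → ℝ} {Bad : Finset ι} {Z : ℝ} {ev : ι → Set Ω}
  {obs : Ω → ℝ} {ob : ℝ} {E : Λ → BlockIdx d N → Set Ω} {r : ℝ}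

/-- **W4b′'s READING ON A COARSER BLOCK TORUS FROM ITS EVENT HALF + A FINER RP FIVE-TUPLE**: event half relative to
the re-indexed reflections ∕ positive algebras `θ i (φ k)`, `mP i (φ k)`, `prob`, and the RP five-tuple over the finer index
`ZMod N₁`. [folklore] -/
theorem _root_.Summit.QuantumFields.BalabanUV.T4Continuum.HistoryChessboardEventsSplit.EventSide.cutoffReading_reindex
    (φ : ZMod N → ZMod N₁)
    (H : EventSide d N P T A Bad μ Z ev obs ob E (fun i k => θ i (φ k)) (fun i k => mP i (φ k)) r)
    (hprob : IsProbabilityMeasure μ)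
    (h5 : (∀ (i : Fin d) (k : ZMod N₁), mP i k ≤ ‹MeasurableSpace Ω›) ∧
      (∀ (i : Fin d) (k : ZMod N₁), Measurable (θ i k)) ∧
      (∀ (i : Fin d) (k : ZMod N₁), MeasurePreserving (θ i k) μ μ) ∧
      (∀ (i : Fin d) (k : ZMod N₁), θ i k ∘ θ i k = id) ∧
      (∀ (i : Fin d) (k : ZMod N₁), IsReflectionPositiveBdd μ (mP i k) (θ i k))) :
    CutoffReading d N P T A Bad μ Z ev obs ob E (fun i k => θ i (φ k)) (fun i k => mP i (φ k)) r :=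
  H.cutoffReading hprob (rp5_reindex φ h5)

end Reindex

/-! ## §2 The tower law at the cube-boundary cuts -/

section Cubes

variable {P : Params} {G : Type*} [GaugeGroup G] {M N K : ℕ}

/-- **THE UNIT-HYPERPLANE INDEX OF THE `k`-TH CUBE BOUNDARY** of axis `i` at the top level `K` whose sites are grouped
into cubes of side `M` (`h : sitesPerDir K = M · N`). -/
def cubeCut (h : P.sitesPerDir K = M * N) (k : ZMod N) : ZMod (P.sitesPerDir K) := castZ h.symm (mulIdx M k)

/-- the representative of the cube cut: `M·k`. [folklore] -/
@[simp] theorem val_cubeCut [NeZero N] (h : P.sitesPerDir K = M * N) (k : ZMod N) : (cubeCut h k).val = M * k.val := by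
  rw [cubeCut, val_castZ, val_mulIdx]

/-- **SLAB, in the cube letters**: a unit label `x` whose cube is in `halfPlus N i k` lies in the positive slab of the cube
cut `k` — the hypothesis shape of W3m-2's `measurable_coord_of_translate_mem_posBonds` ∕ of a column-algebra `loc`
supplier (`(x − cubeCut h k).val < N_K ∕ 2`). [folklore] -/
theorem val_sub_cubeCut_lt_half [NeZero N] (h : P.sitesPerDir K = M * N) (x : ZMod (P.sitesPerDir K)) (k : ZMod N)
    (hc : (cubeIdx M N x - k).val < N / 2) : (x - cubeCut h k).val < P.sitesPerDir K / 2 :=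
  val_sub_castZ_mulIdx_lt_half h x k hc

/-- **REFLECTION, in the cube letters**: the unit reflection `x ↦ 2·(cubeCut h k) − 1 − x` (the `i`-label map of W3m-2's
`cutBond` at the cube cut, by `cbond_src_apply`) acts on cube indices by `cellReflect i k`'s `c ↦ 2k − 1 − c`. [folklore] -/
theorem cubeIdx_reflect_cubeCut [NeZero N] (h : P.sitesPerDir K = M * N) (x : ZMod (P.sitesPerDir K)) (k : ZMod N) :
    cubeIdx M N (2 * cubeCut h k - 1 - x) = 2 * k - 1 - cubeIdx M N x :=
  cubeIdx_reflect_castZ h x k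

/-- **THE REFLECTION IN THE `k`-TH CUBE BOUNDARY** of axis `i`: W3m's `cutRefl` there. -/
def cubeRefl (h : P.sitesPerDir K = M * N) (i : Fin P.d) (k : ZMod N) : Tower P G K → Tower P G K :=
  cutRefl K i (cubeCut h k)

/-- `cubeRefl` unfolds to `cutRefl` at the cube cut. [folklore] -/
theorem cubeRefl_eq (h : P.sitesPerDir K = M * N) (i : Fin P.d) (k : ZMod N) :
    cubeRefl (G := G) h i k = cutRefl K i (cubeCut h k) := rfl

variable [MeasurableSpace G]

/-- **THE POSITIVE σ-ALGEBRA OF THE `k`-TH CUBE BOUNDARY** of axis `i`: W3m's `cutPos` there. -/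
abbrev cubePos (G : Type*) [MeasurableSpace G] (h : P.sitesPerDir K = M * N) (i : Fin P.d) (k : ZMod N) :
    MeasurableSpace (Tower P G K) :=
  cutPos G K i (cubeCut h k)

variable {n : ℕ} [NeZero n]

/-- **THE FIVE RP FIELDS FOR THE `SU(n)` GIBBS TOWER AT THE CUBE CUTS** (W3m's `cutoffRP_towerLaw_gibbs_SU` re-indexed
by `cubeCut`): for every axis `i` and every cube boundary `k : ZMod N`. [folklore] -/
theorem cutoffRP_towerLaw_gibbs_SU_cubes (P : Params) {β : ℝ} (hβ : 0 ≤ β)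
    (ℰ : ℕ → LoopAverage (Matrix.specialUnitaryGroup (Fin n) ℂ))
    (hE : ∀ k l, Measurable fun W : Fin (l + 1) → Matrix.specialUnitaryGroup (Fin n) ℂ => (ℰ k).E W)
    (K : ℕ) (hK : K ≤ P.m + P.K) (h : P.sitesPerDir K = M * N) :
    (∀ (i : Fin P.d) (k : ZMod N), cubePos (Matrix.specialUnitaryGroup (Fin n) ℂ) h i k ≤
        (instMeasurableSpaceTower P (Matrix.specialUnitaryGroup (Fin n) ℂ) K :
          MeasurableSpace (Tower P (Matrix.specialUnitaryGroup (Fin n) ℂ) K))) ∧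
      (∀ (i : Fin P.d) (k : ZMod N), Measurable (cubeRefl (G := Matrix.specialUnitaryGroup (Fin n) ℂ) h i k)) ∧
      (∀ (i : Fin P.d) (k : ZMod N), MeasurePreserving (cubeRefl h i k)
        (towerLaw (T4GenFunBounds.gibbsMeasure (G := Matrix.specialUnitaryGroup (Fin n) ℂ) P β)
          (fun k => blockAvg (P := P) (j := k) (ℰ k)) K)
        (towerLaw (T4GenFunBounds.gibbsMeasure (G := Matrix.specialUnitaryGroup (Fin n) ℂ) P β)
          (fun k => blockAvg (P := P) (j := k) (ℰ k)) K)) ∧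
      (∀ (i : Fin P.d) (k : ZMod N),
        cubeRefl (G := Matrix.specialUnitaryGroup (Fin n) ℂ) h i k ∘ cubeRefl h i k = id) ∧
      (∀ (i : Fin P.d) (k : ZMod N),
        IsReflectionPositiveBdd
          (towerLaw (T4GenFunBounds.gibbsMeasure (G := Matrix.specialUnitaryGroup (Fin n) ℂ) P β)
            (fun k => blockAvg (P := P) (j := k) (ℰ k)) K)
          (cubePos (Matrix.specialUnitaryGroup (Fin n) ℂ) h i k) (cubeRefl h i k)) :=
  rp5_reindex (cubeCut h) (cutoffRP_towerLaw_gibbs_SU P hβ ℰ hE K hK)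

variable {ι Λ : Type*} {Pat : Finset Λ} {T : Finset ι} {A : ℝ → ι → ℝ} {Bad : Finset ι} {Z : ℝ} {r : ℝ} [NeZero N]

/-- **W4b′'s READING OVER THE CUBE TORUS FOR THE `SU(n)` GIBBS TOWER, FROM ITS EVENT HALF ALONE**: carrier
`Tower P SU(n) K`, cells `BlockIdx P.d N` = cubes of side `M` of the top lattice (`sitesPerDir K = M·N`), `θ := cubeRefl`,
`mP := cubePos`; `prob` and the RP half BY NAME (W3m, W3h). [folklore] -/
theorem _root_.Summit.QuantumFields.BalabanUV.T4Continuum.HistoryChessboardEventsSplit.EventSide.cutoffReading_towerLaw_gibbs_SU_cubes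
    (P : Params) {β : ℝ} (hβ : 0 ≤ β) (ℰ : ℕ → LoopAverage (Matrix.specialUnitaryGroup (Fin n) ℂ))
    (hE : ∀ k l, Measurable fun W : Fin (l + 1) → Matrix.specialUnitaryGroup (Fin n) ℂ => (ℰ k).E W)
    (hK : K ≤ P.m + P.K) (h : P.sitesPerDir K = M * N)
    {ev : ι → Set (Tower P (Matrix.specialUnitaryGroup (Fin n) ℂ) K)}
    {obs : Tower P (Matrix.specialUnitaryGroup (Fin n) ℂ) K → ℝ} {ob : ℝ}
    {E : Λ → BlockIdx P.d N → Set (Tower P (Matrix.specialUnitaryGroup (Fin n) ℂ) K)}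
    (H : EventSide P.d N Pat T A Bad
      (towerLaw (T4GenFunBounds.gibbsMeasure (G := Matrix.specialUnitaryGroup (Fin n) ℂ) P β)
        (fun k => blockAvg (P := P) (j := k) (ℰ k)) K)
      Z ev obs ob E (cubeRefl h) (cubePos (Matrix.specialUnitaryGroup (Fin n) ℂ) h) r) :
    CutoffReading P.d N Pat T A Bad
      (towerLaw (T4GenFunBounds.gibbsMeasure (G := Matrix.specialUnitaryGroup (Fin n) ℂ) P β)
        (fun k => blockAvg (P := P) (j := k) (ℰ k)) K)
      Z ev obs ob E (cubeRefl h) (cubePos (Matrix.specialUnitaryGroup (Fin n) ℂ) h) r := by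
  haveI := T4GenFunBounds.isProbabilityMeasure_gibbsMeasure (G := Matrix.specialUnitaryGroup (Fin n) ℂ) P hβ
  exact H.cutoffReading (isProbabilityMeasure_towerLaw (fun k => measurable_avgFun (ℰ k) (hE k)) _ K)
    (cutoffRP_towerLaw_gibbs_SU_cubes P hβ ℰ hE K hK h)

end Cubes

/-! ## §3 The cutoff family with cube cells; the END -/

section Family

/-- **THE UNIT LATTICE OF CUTOFF `K` IS TILED BY `2·L^{m−m₁}` CUBES OF SIDE `L^{m₁}` PER DIRECTION** (`m₁ ≤ m`). [folklore] -/
theorem sitesPerDir_cutoffParams_self_eq_mul (P₀ : Params) {m₁ : ℕ} (hm₁ : m₁ ≤ P₀.m) (K : ℕ) :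
    (cutoffParams P₀ K).sitesPerDir K = P₀.L ^ m₁ * (2 * P₀.L ^ (P₀.m - m₁)) := by
  rw [sitesPerDir_cutoffParams_self, mul_left_comm, ← pow_add, Nat.add_sub_cancel' hm₁]

/-- the cube count `2·L^{m−m₁}` is even — W4's format hypothesis `Even N` is a THEOREM for cube cells too. [folklore] -/
theorem even_cubeCount (P₀ : Params) (m₁ : ℕ) : Even (2 * P₀.L ^ (P₀.m - m₁)) := even_two_mul _

/-- `2·L^{m−m₁} ≠ 0`. [folklore] -/
instance neZero_cubeCount (P₀ : Params) (m₁ : ℕ) : NeZero (2 * P₀.L ^ (P₀.m - m₁)) :=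
  ⟨mul_ne_zero two_ne_zero (pow_ne_zero _ P₀.L_pos.ne')⟩

variable {n : ℕ} [NeZero n] {ι Λ : Type*} [DecidableEq ι] {Pat : Finset Λ} {T : ℕ → Finset ι} {K₀ : ℕ}
  {A B shA shB Cc Rr CcRec RrRec : ℕ → ℝ → ι → ℝ} {Bad : ℕ → Finset ι} {Z Z' : ℕ → ℝ}
  {r r' ν u s₂ c₀ rr s Wsh : ℕ → ℝ} {l₀ vol : ℝ}

/-- **THE ROAD'S END OVER THE `SU(n)` GIBBS TOWERS WITH CUBE CELLS OF SIDE `L^{m₁}`** (node U5, seam (ζ′)): run A =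
the towers over `cutoffParams P₀ K` (couplings `βA K ≥ 0`, averagings `ℰA K k`), run B likewise; cells = the
`N := 2·L^{m−m₁}` cubes per direction of the unit lattice (the SAME block torus `BlockIdx P₀.d N` at every cutoff); at
every cutoff `K ≥ K₀` ONLY THE EVENT HALVES (relative to `cubePos`∕`cubeRefl`) are hypotheses — `prob`, the RP half (W3m)
and `Even N` are PRODUCED; then file 3's `hybridNE7_of_cutoffReadings` verbatim.  Nothing PRINTED is asserted; NE7b is NOT
proved by this. [folklore] -/
theorem hybridNE7_of_towerEventSidesCubes_SU (P₀ : Params) {m₁ : ℕ} (hm₁ : m₁ ≤ P₀.m) {βA βB : ℕ → ℝ}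
    (hβA : ∀ K, 0 ≤ βA K) (hβB : ∀ K, 0 ≤ βB K) (ℰA ℰB : ℕ → ℕ → LoopAverage (Matrix.specialUnitaryGroup (Fin n) ℂ))
    (hEA : ∀ K k l, Measurable fun W : Fin (l + 1) → Matrix.specialUnitaryGroup (Fin n) ℂ => (ℰA K k).E W)
    (hEB : ∀ K k l, Measurable fun W : Fin (l + 1) → Matrix.specialUnitaryGroup (Fin n) ℂ => (ℰB K k).E W)
    {ev : ∀ K, ι → Set (Tower (cutoffParams P₀ K) (Matrix.specialUnitaryGroup (Fin n) ℂ) K)}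
    {obs : ∀ K, Tower (cutoffParams P₀ K) (Matrix.specialUnitaryGroup (Fin n) ℂ) K → ℝ} {ob : ℝ}
    {E : ∀ K, Λ → BlockIdx P₀.d (2 * P₀.L ^ (P₀.m - m₁)) →
      Set (Tower (cutoffParams P₀ K) (Matrix.specialUnitaryGroup (Fin n) ℂ) K)}
    {ev' : ∀ K, ι → Set (Tower (cutoffParams P₀ K) (Matrix.specialUnitaryGroup (Fin n) ℂ) K)}
    {obs' : ∀ K, Tower (cutoffParams P₀ K) (Matrix.specialUnitaryGroup (Fin n) ℂ) K → ℝ}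
    {E' : ∀ K, Λ → BlockIdx P₀.d (2 * P₀.L ^ (P₀.m - m₁)) →
      Set (Tower (cutoffParams P₀ K) (Matrix.specialUnitaryGroup (Fin n) ℂ) K)}
    (HA : ∀ K, K₀ ≤ K → EventSide P₀.d (2 * P₀.L ^ (P₀.m - m₁)) Pat (T K) (A K) (Bad K)
      (towerLaw (T4GenFunBounds.gibbsMeasure (G := Matrix.specialUnitaryGroup (Fin n) ℂ) (cutoffParams P₀ K) (βA K))
        (fun k => blockAvg (P := cutoffParams P₀ K) (j := k) (ℰA K k)) K)
      (Z K) (ev K) (obs K) ob (E K)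
      (cubeRefl (P := cutoffParams P₀ K) (sitesPerDir_cutoffParams_self_eq_mul P₀ hm₁ K))
      (cubePos (P := cutoffParams P₀ K) (Matrix.specialUnitaryGroup (Fin n) ℂ)
        (sitesPerDir_cutoffParams_self_eq_mul P₀ hm₁ K)) (r K))
    (HB : ∀ K, K₀ ≤ K → EventSide P₀.d (2 * P₀.L ^ (P₀.m - m₁)) Pat (T K) (B K) (Bad K)
      (towerLaw (T4GenFunBounds.gibbsMeasure (G := Matrix.specialUnitaryGroup (Fin n) ℂ) (cutoffParams P₀ K) (βB K))
        (fun k => blockAvg (P := cutoffParams P₀ K) (j := k) (ℰB K k)) K)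
      (Z' K) (ev' K) (obs' K) ob (E' K)
      (cubeRefl (P := cutoffParams P₀ K) (sitesPerDir_cutoffParams_self_eq_mul P₀ hm₁ K))
      (cubePos (P := cutoffParams P₀ K) (Matrix.specialUnitaryGroup (Fin n) ℂ)
        (sitesPerDir_cutoffParams_self_eq_mul P₀ hm₁ K)) (r' K))
    (hr : Summable r) (hr' : Summable r')
    (hSh : ShellWeightBound l₀ T A B shA shB Wsh)
    (hTB : ReindexedBudget l₀ vol T (fun K t τ => A K t τ - shA K t τ) (fun K t τ => B K t τ - shB K t τ)
      (fun K _ => Bad K) Cc Rr CcRec RrRec ν u s₂ c₀ rr s)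
    (hrr : Summable rr) (hu : Summable u) (hs : Summable s) (hs₂ : Summable s₂) :
    ∃ K₁ K₂, K₀ ≤ K₁ ∧ HybridNE7 l₀ vol (fun K => T (K₁ + (K₂ + K))) (fun K => A (K₁ + (K₂ + K)))
      (fun K => B (K₁ + (K₂ + K))) (fun K _ => Bad (K₁ + (K₂ + K)))
      (fun K => Real.exp (2 * (ob * l₀)) *
        ((#Pat : ℝ) * ((2 * P₀.L ^ (P₀.m - m₁) : ℕ) : ℝ) ^ P₀.d * (r (K₁ + (K₂ + K)) + r' (K₁ + (K₂ + K)))))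
      (fun K => shA (K₁ + (K₂ + K))) (fun K => shB (K₁ + (K₂ + K))) (fun K => Wsh (K₁ + (K₂ + K)))
      (fun K => (rr (K₁ + (K₂ + K)) + u (K₁ + (K₂ + K))) + (s (K₁ + (K₂ + K)) + s₂ (K₁ + (K₂ + K)))) :=
  hybridNE7_of_cutoffReadings (even_cubeCount P₀ m₁)
    (fun K hK => (HA K hK).cutoffReading_towerLaw_gibbs_SU_cubes (cutoffParams P₀ K) (hβA K) (ℰA K) (hEA K)
      (le_m_add_K_cutoffParams P₀ K) (sitesPerDir_cutoffParams_self_eq_mul P₀ hm₁ K))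
    (fun K hK => (HB K hK).cutoffReading_towerLaw_gibbs_SU_cubes (cutoffParams P₀ K) (hβB K) (ℰB K) (hEB K)
      (le_m_add_K_cutoffParams P₀ K) (sitesPerDir_cutoffParams_self_eq_mul P₀ hm₁ K))
    hr hr' hSh hTB hrr hu hs hs₂

end Family

end

end Summit.QuantumFields.BalabanUV.T4Continuum.HistoryChessboardEventsCubes
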